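import Mathlib
import Summits.Ventures.PercRepro2.OneTypedEdge
import Summits.Ventures.PercRepro2.TypedSplit
import Summits.Ventures.PercRepro2.TypedUntouched
import Summits.Ventures.PercRepro2.TypedSwapRoots
import Summits.Ventures.PercRepro2.TypedCoincRootEdge
import Summits.Ventures.PercRepro2.TypedTriangleTwo

/-!
# The first pointwise-symmetrised POSITIVITY rules of row 2′TRI: `o` and `b` together in a root
cluster (blind cell PercRepro2, night-3 g14, 2026-08-27; `proofs/NIGHT3-CERT.md` §23.6)

**State level** (`decide`, 8,192 cases each): the `S₃`-symmetrised kernel is NONNEGATIVE on every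
state triple in which two states carry `o, b ∈ C(a₁)` (`KBsym_nonneg_of_two_LL`), two carry
`o, b ∈ C(a₂)` (`KBsym_nonneg_of_two_HH`), or one carries `o, b ∈ C(a₁)` and another
`o, b ∈ C(a₂)` (`KBsym_nonneg_of_LL_HH`) — three of the 33 minimal monotone nonnegativity
conditions of the symmetrised kernel (`mining/night-3/g14/posclass.py`).

**Graph level** — four typed patterns force every typed triple into one of these conditions or into
a root connection (`Q` fails, kernel `0`), so the typed base of EVERY instance containing them is
nonnegative (the first class theorems of row 2′TRI of pointwise-symmetrised type; random census
`census_pos.py`: 0 negative, e.g. 1,202 positive / 2,102 zero of 3,304 for the triangle):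
* the type-2 triangle `{a₁, o, b}` (`typedCount_nonneg_of_triangle_ob`);
* the path `a₁ – o – b – a₂` of three type-2 edges (`typedCount_nonneg_of_path_obp`);
* (in `TypedPositiveOBStar.lean`) `o` adjacent to both roots and to `b`, the `a₁`-edge of type 1,
  the others of type 2 (`typedCount_nonneg_of_o_star`), and the same with `b` in the place of `o`
  (`typedCount_nonneg_of_b_star`);
* mirrors at `a₂` by the root symmetry.
Nothing here asserts anything about the original lane.
-/

namespace Summit.Ventures.PercRepro2

open UnionCluster

namespace CovForm

namespace PositiveOB

open OneTyped Untouched CoincRoot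

/-! ## The state-level inequalities -/

section States

/-- Two states carrying `o, b ∈ C(a₁)`: the symmetrised kernel is nonnegative (8,192 cases). -/
theorem KBsym_nonneg_of_two_LL (x : St) (q L3 H3 q' L3' H3' : Bool) :
    0 ≤ KBsym x (mkSt q true true L3 false false H3) (mkSt q' true true L3' false false H3') := by
  revert x q L3 H3 q' L3' H3'
  decide +kernel

/-- Two states carrying `o, b ∈ C(a₂)`: the symmetrised kernel is nonnegative (8,192 cases). -/
theorem KBsym_nonneg_of_two_HH (x : St) (q L3 H3 q' L3' H3' : Bool) :
    0 ≤ KBsym x (mkSt q false false L3 true true H3) (mkSt q' false false L3' true true H3') := by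
  revert x q L3 H3 q' L3' H3'
  decide +kernel

/-- One state carrying `o, b ∈ C(a₁)` and one carrying `o, b ∈ C(a₂)`: the symmetrised kernel is
nonnegative (8,192 cases). -/
theorem KBsym_nonneg_of_LL_HH (x : St) (q L3 H3 q' L3' H3' : Bool) :
    0 ≤ KBsym x (mkSt q true true L3 false false H3) (mkSt q' false false L3' true true H3') := by
  revert x q L3 H3 q' L3' H3'
  decide +kernel

end States

/-! ## The states of configurations with `o, b` in a root cluster -/

section Graph

open Classical

variable {V : Type*} {E : Type*} [Fintype E] [DecidableEq E]
variable (ends : E → Sym2 V) (o a₁ a₂ a₃ b : V)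

omit [Fintype E] [DecidableEq E] in
/-- A configuration with `o, b ∈ C(a₁)` either fails `Q` or has the state
`mkSt false true true L₃ false false H₃`. -/
lemma st_of_LL (u : Config E) (ho : Conn ends u a₁ o) (hb : Conn ends u a₁ b) :
    (st ends o a₁ a₂ a₃ b u).q' = true ∨
      st ends o a₁ a₂ a₃ b u =
        mkSt false true true (decide (Conn ends u a₁ a₃)) false false (decide (Conn ends u a₂ a₃)) := by
  by_cases hq : Conn ends u a₂ a₁
  · left
    unfold st St.q'
    exact decide_eq_true hq
  · right
    have ho' : ¬ Conn ends u a₂ o := fun h' => hq (conn_trans h' (conn_symm ho))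
    have hb' : ¬ Conn ends u a₂ b := fun h' => hq (conn_trans h' (conn_symm hb))
    unfold st mkSt
    simp only [ho, hb, ho', hb', decide_true, decide_false, hq]

omit [Fintype E] [DecidableEq E] in
/-- A configuration with `o, b ∈ C(a₂)` either fails `Q` or has the state
`mkSt false false false L₃ true true H₃`. -/
lemma st_of_HH (u : Config E) (ho : Conn ends u a₂ o) (hb : Conn ends u a₂ b) :
    (st ends o a₁ a₂ a₃ b u).q' = true ∨
      st ends o a₁ a₂ a₃ b u =
        mkSt false false false (decide (Conn ends u a₁ a₃)) true true (decide (Conn ends u a₂ a₃)) := by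
  by_cases hq : Conn ends u a₂ a₁
  · left
    unfold st St.q'
    exact decide_eq_true hq
  · right
    have ho' : ¬ Conn ends u a₁ o := fun h' => hq (conn_symm (conn_trans h' (conn_symm ho)))
    have hb' : ¬ Conn ends u a₁ b := fun h' => hq (conn_symm (conn_trans h' (conn_symm hb)))
    unfold st mkSt
    simp only [ho, hb, ho', hb', decide_true, decide_false, hq]

omit [Fintype E] [DecidableEq E] in
/-- The symmetrised kernel is nonnegative on a triple two of whose copies have `o, b` together in a
root cluster (`C(a₁)` or `C(a₂)`, each). -/
lemma KBsym_st_nonneg_of_two (t u v : Config E) (hu : ((Conn ends u a₁ o ∧ Conn ends u a₁ b) ∨ (Conn ends u a₂ o ∧ Conn ends u a₂ b)))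
    (hv : ((Conn ends v a₁ o ∧ Conn ends v a₁ b) ∨ (Conn ends v a₂ o ∧ Conn ends v a₂ b))) :
    0 ≤ KBsym (st ends o a₁ a₂ a₃ b t) (st ends o a₁ a₂ a₃ b u) (st ends o a₁ a₂ a₃ b v) := by
  rcases hu with ⟨huo, hub⟩ | ⟨huo, hub⟩ <;> rcases hv with ⟨hvo, hvb⟩ | ⟨hvo, hvb⟩
  · rcases st_of_LL ends o a₁ a₂ a₃ b u huo hub with hq | hs
    · rw [KBsym_eq_zero_of_q' _ _ _ (Or.inr (Or.inl hq))]
    rcases st_of_LL ends o a₁ a₂ a₃ b v hvo hvb with hq | hs'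
    · rw [KBsym_eq_zero_of_q' _ _ _ (Or.inr (Or.inr hq))]
    rw [hs, hs']
    exact KBsym_nonneg_of_two_LL _ _ _ _ _ _ _
  · rcases st_of_LL ends o a₁ a₂ a₃ b u huo hub with hq | hs
    · rw [KBsym_eq_zero_of_q' _ _ _ (Or.inr (Or.inl hq))]
    rcases st_of_HH ends o a₁ a₂ a₃ b v hvo hvb with hq | hs'
    · rw [KBsym_eq_zero_of_q' _ _ _ (Or.inr (Or.inr hq))]
    rw [hs, hs']
    exact KBsym_nonneg_of_LL_HH _ _ _ _ _ _ _
  · rcases st_of_HH ends o a₁ a₂ a₃ b u huo hub with hq | hs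
    · rw [KBsym_eq_zero_of_q' _ _ _ (Or.inr (Or.inl hq))]
    rcases st_of_LL ends o a₁ a₂ a₃ b v hvo hvb with hq | hs'
    · rw [KBsym_eq_zero_of_q' _ _ _ (Or.inr (Or.inr hq))]
    rw [hs, hs', KBsym_comm_right]
    exact KBsym_nonneg_of_LL_HH _ _ _ _ _ _ _
  · rcases st_of_HH ends o a₁ a₂ a₃ b u huo hub with hq | hs
    · rw [KBsym_eq_zero_of_q' _ _ _ (Or.inr (Or.inl hq))]
    rcases st_of_HH ends o a₁ a₂ a₃ b v hvo hvb with hq | hs'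
    · rw [KBsym_eq_zero_of_q' _ _ _ (Or.inr (Or.inr hq))]
    rw [hs, hs']
    exact KBsym_nonneg_of_two_HH _ _ _ _ _ _ _

omit [Fintype E] [DecidableEq E] in
/-- The symmetrised kernel is nonnegative on a triple in which two copies have `o, b` together in a
root cluster, whichever two. -/
lemma KBsym_st_nonneg_of_two_any (x y w : Config E)
    (h : (((Conn ends x a₁ o ∧ Conn ends x a₁ b) ∨ (Conn ends x a₂ o ∧ Conn ends x a₂ b)) ∧ ((Conn ends y a₁ o ∧ Conn ends y a₁ b) ∨ (Conn ends y a₂ o ∧ Conn ends y a₂ b))) ∨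
      (((Conn ends x a₁ o ∧ Conn ends x a₁ b) ∨ (Conn ends x a₂ o ∧ Conn ends x a₂ b)) ∧ ((Conn ends w a₁ o ∧ Conn ends w a₁ b) ∨ (Conn ends w a₂ o ∧ Conn ends w a₂ b))) ∨
      (((Conn ends y a₁ o ∧ Conn ends y a₁ b) ∨ (Conn ends y a₂ o ∧ Conn ends y a₂ b)) ∧ ((Conn ends w a₁ o ∧ Conn ends w a₁ b) ∨ (Conn ends w a₂ o ∧ Conn ends w a₂ b)))) :
    0 ≤ KBsym (st ends o a₁ a₂ a₃ b x) (st ends o a₁ a₂ a₃ b y) (st ends o a₁ a₂ a₃ b w) := by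
  rcases h with ⟨hx, hy⟩ | ⟨hx, hw⟩ | ⟨hy, hw⟩
  · rw [KBsym_comm_right, KBsym_comm_left]
    exact KBsym_st_nonneg_of_two ends o a₁ a₂ a₃ b w x y hx hy
  · rw [KBsym_comm_left]
    exact KBsym_st_nonneg_of_two ends o a₁ a₂ a₃ b y x w hx hw
  · exact KBsym_st_nonneg_of_two ends o a₁ a₂ a₃ b x y w hy hw

omit [Fintype E] [DecidableEq E] in
/-- The symmetrised kernel vanishes on a triple in which some copy joins the roots. -/
lemma KBsym_st_eq_zero_of_conn (x y w : Config E)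
    (h : Conn ends x a₂ a₁ ∨ Conn ends y a₂ a₁ ∨ Conn ends w a₂ a₁) :
    KBsym (st ends o a₁ a₂ a₃ b x) (st ends o a₁ a₂ a₃ b y) (st ends o a₁ a₂ a₃ b w) = 0 := by
  have hq : ∀ u : Config E, Conn ends u a₂ a₁ → (st ends o a₁ a₂ a₃ b u).q' = true := fun u hu => by
    unfold st St.q'
    exact decide_eq_true hu
  rcases h with h | h | h
  · exact KBsym_eq_zero_of_q' _ _ _ (Or.inl (hq x h))
  · exact KBsym_eq_zero_of_q' _ _ _ (Or.inr (Or.inl (hq y h)))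
  · exact KBsym_eq_zero_of_q' _ _ _ (Or.inr (Or.inr (hq w h)))

end Graph

/-! ## The colouring case analyses -/

section Cases

variable {E : Type*}

/-- The path `a₁ – o – b – a₂` of type-2 edges `e, f, g`: some copy carries all three, or two copies
carry `e, f`, or one carries `e, f` and another `f, g`. -/
lemma path_cases {x y w : Config E} {e f g : E}
    (he : (x e).toNat + (y e).toNat + (w e).toNat = 2)
    (hf : (x f).toNat + (y f).toNat + (w f).toNat = 2)
    (hg : (x g).toNat + (y g).toNat + (w g).toNat = 2) :
    ((x e = true ∧ x f = true ∧ x g = true) ∨ (y e = true ∧ y f = true ∧ y g = true) ∨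
      (w e = true ∧ w f = true ∧ w g = true)) ∨
    (((x e = true ∧ x f = true) ∨ (x f = true ∧ x g = true)) ∧
        ((y e = true ∧ y f = true) ∨ (y f = true ∧ y g = true))) ∨
    (((x e = true ∧ x f = true) ∨ (x f = true ∧ x g = true)) ∧
        ((w e = true ∧ w f = true) ∨ (w f = true ∧ w g = true))) ∨
    (((y e = true ∧ y f = true) ∨ (y f = true ∧ y g = true)) ∧
        ((w e = true ∧ w f = true) ∨ (w f = true ∧ w g = true))) := by
  cases hxe : x e <;> cases hye : y e <;> cases hwe : w e <;> cases hxf : x f <;> cases hyf : y f <;>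
    cases hwf : w f <;> cases hxg : x g <;> cases hyg : y g <;> cases hwg : w g <;> simp_all

/-- The star at `o`: `e = {a₁, o}` of type 1, `f = {a₂, o}`, `g = {o, b}` of type 2: some copy carries
`e, f`, or two copies each carry `e, g` or `f, g`. -/
lemma star_cases {x y w : Config E} {e f g : E}
    (he : (x e).toNat + (y e).toNat + (w e).toNat = 1)
    (hf : (x f).toNat + (y f).toNat + (w f).toNat = 2)
    (hg : (x g).toNat + (y g).toNat + (w g).toNat = 2) :
    ((x e = true ∧ x f = true) ∨ (y e = true ∧ y f = true) ∨ (w e = true ∧ w f = true)) ∨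
    (((x e = true ∧ x g = true) ∨ (x f = true ∧ x g = true)) ∧
        ((y e = true ∧ y g = true) ∨ (y f = true ∧ y g = true))) ∨
    (((x e = true ∧ x g = true) ∨ (x f = true ∧ x g = true)) ∧
        ((w e = true ∧ w g = true) ∨ (w f = true ∧ w g = true))) ∨
    (((y e = true ∧ y g = true) ∨ (y f = true ∧ y g = true)) ∧
        ((w e = true ∧ w g = true) ∨ (w f = true ∧ w g = true))) := by
  cases hxe : x e <;> cases hye : y e <;> cases hwe : w e <;> cases hxf : x f <;> cases hyf : y f <;>
    cases hwf : w f <;> cases hxg : x g <;> cases hyg : y g <;> cases hwg : w g <;> simp_all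

end Cases

/-! ## The theorems -/

section Main

open Classical

variable {V : Type*} {E : Type*} [Fintype E] [DecidableEq E] {R : Type*} [Field R]
  [LinearOrder R] [IsStrictOrderedRing R]
variable (ends : E → Sym2 V) (o a₁ a₂ a₃ b : V)

/-- A typed count of a kernel nonnegative on the support of the count is nonnegative. -/
lemma typedCount_nonneg_of_nonneg_on_support (F : Finset E)
    (z : Config E) (τ : E → ℕ) {K : Config E → Config E → Config E → R}
    (hK : ∀ x y w, (∀ e, e ∉ F → x e = z e ∧ y e = z e ∧ w e = z e) →
      (∀ e ∈ F, openCount x y w e = τ e) → 0 ≤ K x y w) :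
    0 ≤ typedCount F z τ K := by
  unfold typedCount
  refine Finset.sum_nonneg fun x _ => Finset.sum_nonneg fun y _ => Finset.sum_nonneg fun w _ => ?_
  split_ifs with h
  · exact hK x y w h.1 h.2
  · exact le_refl _

/-- The typed base is nonnegative as soon as the symmetrised kernel on states is nonnegative on
every typed triple. -/
lemma typedCount_nonneg_of_KBsym (F : Finset E) (z : Config E) (τ : E → ℕ)
    (hτ : ∀ e ∈ F, τ e = 1 ∨ τ e = 2)
    (h : ∀ x y w : Config E, (∀ e, e ∉ F → x e = z e ∧ y e = z e ∧ w e = z e) →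
      (∀ e ∈ F, openCount x y w e = τ e) →
      0 ≤ KBsym (st ends o a₁ a₂ a₃ b x) (st ends o a₁ a₂ a₃ b y) (st ends o a₁ a₂ a₃ b w)) :
    0 ≤ typedCount F z τ (K3 ends o a₁ a₂ a₃ b : Config E → Config E → Config E → R) := by
  have h6 := Triangle.six_mul_typedCount_KBsym'' (R := R) ends o a₁ a₂ a₃ b F z τ hτ
  have hK : 0 ≤ typedCount F z τ (fun x y w => ((KBsym (st ends o a₁ a₂ a₃ b x)
      (st ends o a₁ a₂ a₃ b y) (st ends o a₁ a₂ a₃ b w) : ℤ) : R)) := by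
    refine typedCount_nonneg_of_nonneg_on_support F z τ fun x y w hxyw hτ' => ?_
    exact_mod_cast h x y w hxyw hτ'
  rw [← h6] at hK
  exact (mul_nonneg_iff_of_pos_left (by norm_num : (0 : R) < 6)).1 hK

omit [Fintype E] [DecidableEq E] [LinearOrder R] [IsStrictOrderedRing R] in
/-- A copy carrying two of the three triangle edges `{a₁, o}`, `{a₁, b}`, `{o, b}` has `o, b`
together in `C(a₁)`. -/
lemma together_of_triangle {e f g : E} (he : ends e = s(a₁, o)) (hf : ends f = s(a₁, b))
    (hg : ends g = s(o, b)) (u : Config E)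
    (h : (u e = true ∧ u f = true) ∨ (u e = true ∧ u g = true) ∨ (u f = true ∧ u g = true)) :
    ((Conn ends u a₁ o ∧ Conn ends u a₁ b) ∨ (Conn ends u a₂ o ∧ Conn ends u a₂ b)) := by
  have ce : u e = true → Conn ends u a₁ o := fun hu => conn_of_openAdj ⟨e, hu, he⟩
  have cf : u f = true → Conn ends u a₁ b := fun hu => conn_of_openAdj ⟨f, hu, hf⟩
  have cg : u g = true → Conn ends u o b := fun hu => conn_of_openAdj ⟨g, hu, hg⟩
  left
  rcases h with ⟨h1, h2⟩ | ⟨h1, h2⟩ | ⟨h1, h2⟩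
  · exact ⟨ce h1, cf h2⟩
  · exact ⟨ce h1, conn_trans (ce h1) (cg h2)⟩
  · exact ⟨conn_trans (cf h1) (conn_symm (cg h2)), cf h1⟩

/-- **The type-2 triangle `{a₁, o, b}`: every typed base is nonnegative.** -/
theorem typedCount_nonneg_of_triangle_ob {e f g : E} (he : ends e = s(a₁, o)) (hf : ends f = s(a₁, b))
    (hg : ends g = s(o, b)) (F : Finset E) (heF : e ∈ F) (hfF : f ∈ F) (hgF : g ∈ F) (z : Config E)
    (τ : E → ℕ) (hτ : ∀ e ∈ F, τ e = 1 ∨ τ e = 2) (hτe : τ e = 2) (hτf : τ f = 2) (hτg : τ g = 2) :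
    0 ≤ typedCount F z τ (K3 ends o a₁ a₂ a₃ b : Config E → Config E → Config E → R) := by
  refine typedCount_nonneg_of_KBsym ends o a₁ a₂ a₃ b F z τ hτ fun x y w _ hτ' => ?_
  have h2e := hτ' e heF
  have h2f := hτ' f hfF
  have h2g := hτ' g hgF
  rw [hτe] at h2e
  rw [hτf] at h2f
  rw [hτg] at h2g
  have key := together_of_triangle ends o a₁ a₂ b he hf hg
  rcases Triangle.two_copies_two_open h2e h2f h2g with ⟨hx, hy⟩ | ⟨hx, hw⟩ | ⟨hy, hw⟩
  · exact KBsym_st_nonneg_of_two_any ends o a₁ a₂ a₃ b x y w (Or.inl ⟨key x hx, key y hy⟩)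
  · exact KBsym_st_nonneg_of_two_any ends o a₁ a₂ a₃ b x y w (Or.inr (Or.inl ⟨key x hx, key w hw⟩))
  · exact KBsym_st_nonneg_of_two_any ends o a₁ a₂ a₃ b x y w (Or.inr (Or.inr ⟨key y hy, key w hw⟩))

omit [Fintype E] [DecidableEq E] [LinearOrder R] [IsStrictOrderedRing R] in
/-- On the path `a₁ – o – b – a₂` (edges `e, f, g`), a copy carrying `e, f` has `o, b ∈ C(a₁)` and a
copy carrying `f, g` has `o, b ∈ C(a₂)`. -/
lemma together_of_path {e f g : E} (he : ends e = s(a₁, o)) (hf : ends f = s(o, b))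
    (hg : ends g = s(b, a₂)) (u : Config E)
    (h : (u e = true ∧ u f = true) ∨ (u f = true ∧ u g = true)) : ((Conn ends u a₁ o ∧ Conn ends u a₁ b) ∨ (Conn ends u a₂ o ∧ Conn ends u a₂ b)) := by
  have ce : u e = true → Conn ends u a₁ o := fun hu => conn_of_openAdj ⟨e, hu, he⟩
  have cf : u f = true → Conn ends u o b := fun hu => conn_of_openAdj ⟨f, hu, hf⟩
  have cg : u g = true → Conn ends u b a₂ := fun hu => conn_of_openAdj ⟨g, hu, hg⟩
  rcases h with ⟨h1, h2⟩ | ⟨h1, h2⟩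
  · exact Or.inl ⟨ce h1, conn_trans (ce h1) (cf h2)⟩
  · exact Or.inr ⟨conn_symm (conn_trans (cf h1) (cg h2)), conn_symm (cg h2)⟩

/-- **The path `a₁ – o – b – a₂` of three type-2 edges: every typed base is nonnegative.** -/
theorem typedCount_nonneg_of_path_obp {e f g : E} (he : ends e = s(a₁, o)) (hf : ends f = s(o, b))
    (hg : ends g = s(b, a₂)) (F : Finset E) (heF : e ∈ F) (hfF : f ∈ F) (hgF : g ∈ F) (z : Config E)
    (τ : E → ℕ) (hτ : ∀ e ∈ F, τ e = 1 ∨ τ e = 2) (hτe : τ e = 2) (hτf : τ f = 2) (hτg : τ g = 2) :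
    0 ≤ typedCount F z τ (K3 ends o a₁ a₂ a₃ b : Config E → Config E → Config E → R) := by
  refine typedCount_nonneg_of_KBsym ends o a₁ a₂ a₃ b F z τ hτ fun x y w _ hτ' => ?_
  have h2e := hτ' e heF
  have h2f := hτ' f hfF
  have h2g := hτ' g hgF
  rw [hτe] at h2e
  rw [hτf] at h2f
  rw [hτg] at h2g
  have key := together_of_path ends o a₁ a₂ b he hf hg
  have all : ∀ u : Config E, u e = true ∧ u f = true ∧ u g = true → Conn ends u a₂ a₁ :=
    fun u ⟨h1, h2, h3⟩ => conn_symm (conn_trans (conn_trans (conn_of_openAdj ⟨e, h1, he⟩)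
      (conn_of_openAdj ⟨f, h2, hf⟩)) (conn_of_openAdj ⟨g, h3, hg⟩))
  rcases path_cases h2e h2f h2g with h | ⟨hx, hy⟩ | ⟨hx, hw⟩ | ⟨hy, hw⟩
  · rw [KBsym_st_eq_zero_of_conn ends o a₁ a₂ a₃ b x y w (by
      rcases h with h | h | h
      · exact Or.inl (all x h)
      · exact Or.inr (Or.inl (all y h))
      · exact Or.inr (Or.inr (all w h)))]
  · exact KBsym_st_nonneg_of_two_any ends o a₁ a₂ a₃ b x y w (Or.inl ⟨key x hx, key y hy⟩)
  · exact KBsym_st_nonneg_of_two_any ends o a₁ a₂ a₃ b x y w (Or.inr (Or.inl ⟨key x hx, key w hw⟩))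
  · exact KBsym_st_nonneg_of_two_any ends o a₁ a₂ a₃ b x y w (Or.inr (Or.inr ⟨key y hy, key w hw⟩))

/-- The mirror of the triangle at `a₂`. -/
theorem typedCount_nonneg_of_triangle_ob' {e f g : E} (he : ends e = s(a₂, o)) (hf : ends f = s(a₂, b))
    (hg : ends g = s(o, b)) (F : Finset E) (heF : e ∈ F) (hfF : f ∈ F) (hgF : g ∈ F) (z : Config E)
    (τ : E → ℕ) (hτ : ∀ e ∈ F, τ e = 1 ∨ τ e = 2) (hτe : τ e = 2) (hτf : τ f = 2) (hτg : τ g = 2) :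
    0 ≤ typedCount F z τ (K3 ends o a₁ a₂ a₃ b : Config E → Config E → Config E → R) := by
  rw [← SwapRoots.typedCount_swap_roots ends o a₁ a₂ a₃ b F z τ]
  exact typedCount_nonneg_of_triangle_ob ends o a₂ a₁ a₃ b he hf hg F heF hfF hgF z τ hτ hτe hτf hτg

end Main

end PositiveOB

end CovForm

end Summit.Ventures.PercRepro2
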